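import Mathlib
import HarnessLib
import Literature.MathematicalPhysics.QuantumLattice.HubbardGridCharactersWeighted
import Literature.MathematicalPhysics.QuantumLattice.HubbardUVSymbolCTDifferences
import Summits.HubbardSuperconductivity.HubbardSuperconductivity.Theorems.KLProgrammeKLRegimeEngineScaleZeroE4Assembly

/-!
# K3 engine child (`KLRegimeEngineV14`, stmt-HubbardSuperconductivity-19918), stub `stub_engine_scale0`, clause (E4)₀ `EngineFirstMoments … 0`:
# the first moment from TWO weighted product-torus sums (covariance symbol, multiplier symbol)

Cell gate-hubbard-kl, seat hubbard-kl-k3c2-p1.  `…ScaleZeroE4Assembly.firstMoment_zero_le_of_wgridStep` bounds the first space-time moment of the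
scale-`0` sectorised quartic kernel through the pair-WEIGHTED row/column sums of the grid covariance `Sᵀ C^K_{>e₀} S` (`α_w`) and of the
cross-grid overlap kernel `E₀ S` (`cr_w`, `cc_w`), weight `gridLabelWt L (4M) β = 1 + (β/4M)|Δt|_{4M} + |Δx⃗|_{ℓ^∞}`.  Both kernels are
translation invariant (`HubbardGridCharactersWeighted`): the weighted row and column sums are weighted `ℓ¹` norms of ONE character sum each on
the product torus `(ℤ/4M) × (ℤ/L)²` — of the padded covariance symbol `gridSymbol (uvSymbolCT … K klE0)` and of the scale-`0` multiplier
symbol `F_ω = klAnisoFamily … klE0 0 ω` — against the weight `1 + (β/4M)|ã| + |b̃|_{ℓ^∞}` at the difference point.  This file performs that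
reduction:

* `scaleZeroMomentWeight` is written INLINE as `fun a bv => 1 + (β/N·cyclicDist N (a 0) 0 + torusSiteDist bv 0)`; `gridLabelWt_pair_gridLegPos`,
  `gridLabelWt_pair_latticeLegPos_gridLegPos` identify the pair weights of the step with it; it is even and `≥ 1`;
* **`firstMoment_zero_le_of_torusSums`** — for every `Ω`, `i`, `k`:
  `ε_x³·Σ_x spaceTimeDist(x_i,x_k)·‖klAnisoLegKernel … 0 4 Ω (0,x)‖ ≤ ε_x³·T_w·(2·T_w)³·(ρ⁻⁴·e f₂/(1-θ_w)²)` (`2 = sectorCount 0` sectors),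
  given the weighted torus-sum bounds `A_w` (covariance, enters `θ_w` only) and `T_w` (multiplier), the replica-Gram bound `κ` and `θ_w < 1`.

What remains for (E4)₀ after this file: the two weighted torus sums from symbol differences (`…ScaleZeroE4Alpha*`, `…ScaleZeroE4Overlap*`:
time moment = mixed differences of order `≤ 2` in each variable; space moments = third differences, telescoped over the frame pieces) and the
regime packaging (`θ_w ≤ 1/2` under `klEngU₀3`/`klEngC₃3`, the constant `klE4CE`).

Everything is proved; no definitions, no named facts, no sorry.
-/

noncomputable section

namespace Summit.HubbardSuperconductivity.HubbardSuperconductivity.Theorems.EngineV8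

set_option linter.dupNamespace false -- summit = problem name (single-conjunct summit), D-0017

open Real Finset Complex Literature.MathematicalPhysics.QuantumLattice Literature.Probability.LatticeModels
open Literature.Probability.LatticeModels.BattleFederbush
open Literature.MathematicalPhysics.QuantumLattice.GrassmannAlgebra
open Summit.HubbardSuperconductivity.HubbardSuperconductivity.Theorems.KLRegimeSplit
open Summit.HubbardSuperconductivity.HubbardSuperconductivity.Theorems.DispersionFlow
open Summit.HubbardSuperconductivity.HubbardSuperconductivity.Theorems.KLProgrammeLegKernels
open scoped ComplexConjugate

variable {L M : ℕ} [NeZero L]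

/-! ## §1 The pair weights of the step are the moment weight at the difference point -/

section Weight

variable {Ng : ℕ} [NeZero Ng]

omit [NeZero L] [NeZero Ng] in
/-- `cyclicDist n a b = cyclicDist n (a - b) 0`. -/
theorem cyclicDist_eq_sub_zero (n : ℕ) (a b : ZMod n) : cyclicDist n a b = cyclicDist n (a - b) 0 := by
  simp [cyclicDist]

/-- The moment weight is even: `w(-a, -b) = w(a, b)`. -/
theorem scaleZeroMomentWeight_neg (β : ℝ) (a : TorusSite 1 Ng) (bv : TorusSite 2 L) :
    (1 + (β / Ng * cyclicDist Ng ((-a) 0) 0 + torusSiteDist (-bv) 0) : ℝ) = 1 + (β / Ng * cyclicDist Ng (a 0) 0 + torusSiteDist bv 0) := by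
  have h1 : cyclicDist Ng ((-a) 0) 0 = cyclicDist Ng (a 0) 0 := by
    rw [Pi.neg_apply, (isLabelDist_cyclicDist Ng).symm (a 0) 0, cyclicDist_eq_sub_zero Ng 0 (a 0), zero_sub]
  have h2 : torusSiteDist (-bv) 0 = torusSiteDist bv 0 := by
    rw [(isLabelDist_torusSiteDist (L := L)).symm bv 0, torusSiteDist_eq_sub_zero (0 : TorusSite 2 L) bv, zero_sub]
  rw [h1, h2]

omit [NeZero L] [NeZero Ng] in
/-- The moment weight is at least `1` (hence nonnegative). -/
theorem scaleZeroMomentWeight_nonneg {β : ℝ} (hβ : 0 ≤ β) (a : TorusSite 1 Ng) (bv : TorusSite 2 L) :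
    (0 : ℝ) ≤ 1 + (β / Ng * cyclicDist Ng (a 0) 0 + torusSiteDist bv 0) := by
  have h1 : (0 : ℝ) ≤ cyclicDist Ng (a 0) 0 := Nat.cast_nonneg _
  have h2 : (0 : ℝ) ≤ torusSiteDist bv 0 := Nat.cast_nonneg _
  have h3 : 0 ≤ β / Ng := div_nonneg hβ (Nat.cast_nonneg _)
  nlinarith

/-- **The covariance pair weight**: `wt{pos X, pos Y} = 1 + (β/N)·|j_X - j_Y|_N + |x⃗_X - x⃗_Y|_{ℓ^∞}` for two grid legs. -/
theorem gridLabelWt_pair_gridLegPos {β : ℝ} (hβ : 0 ≤ β) (X Y : GridLeg (GridPoint L Ng)) :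
    gridLabelWt L Ng β {gridLegPos X, gridLegPos Y} =
      1 + (β / Ng * cyclicDist Ng ((fun _ : Fin 1 => ((X.1.1.1 : ℕ) : ZMod Ng) - ((Y.1.1.1 : ℕ) : ZMod Ng)) 0) 0 +
        torusSiteDist (X.1.1.2 - Y.1.1.2) 0) := by
  rw [gridLabelWt_pair L Ng hβ, gridLegPos_apply, gridLegPos_apply, gridLabelDist_apply, cyclicDist_eq_sub_zero Ng,
    torusSiteDist_eq_sub_zero X.1.1.2]

/-- **The overlap pair weight**: `wt{pos'' (y,ℓ), pos ((q,σ),c)} = 1 + (β/N)·|q₀ - 2y₀|_N + |q⃗ - y⃗|_{ℓ^∞}` (`N = 4M`). -/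
theorem gridLabelWt_pair_latticeLegPos_gridLegPos [NeZero M] {β : ℝ} (hβ : 0 ≤ β) {Ns : ℕ} (X'' : SpaceTimeIdx L M × SectorLeg Ns)
    (X' : GridLeg (GridPoint L (2 * (2 * M)))) :
    haveI : NeZero (2 * (2 * M)) := ⟨by have := NeZero.ne M; omega⟩
    gridLabelWt L (2 * (2 * M)) β {latticeLegPos (2 * (2 * M)) X'', gridLegPos X'} =
      1 + (β / (2 * (2 * M) : ℕ) * cyclicDist (2 * (2 * M))
        ((fun _ : Fin 1 => ((X'.1.1.1 : ℕ) : ZMod (2 * (2 * M))) - 2 * ((X''.1.1 : ℕ) : ZMod (2 * (2 * M)))) 0) 0 +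
        torusSiteDist (X'.1.1.2 - X''.1.2) 0) := by
  haveI : NeZero (2 * (2 * M)) := ⟨by have := NeZero.ne M; omega⟩
  rw [gridLabelWt_pair L (2 * (2 * M)) hβ, latticeLegPos_apply, gridLegPos_apply, gridLabelDist_apply,
    (isLabelDist_cyclicDist (2 * (2 * M))).symm, cyclicDist_eq_sub_zero (2 * (2 * M)),
    (isLabelDist_torusSiteDist (L := L)).symm, torusSiteDist_eq_sub_zero X'.1.1.2]
  push_cast
  ring_nf

end Weight

/-! ## §2 The first moment from the two weighted torus sums -/

/-- **(E4)₀'s first moment from TWO weighted product-torus sums** (stub `stub_engine_scale0`, clause (E4)₀, modulo the symbol estimates).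
With `N = 4M`, `w(a, b⃗) = 1 + (β/N)|ã|_N + |b⃗|_{ℓ^∞}`: if the padded covariance symbol `G_σ = gridSymbol (uvSymbolCT … K klE0) σ` has
`Σ_{(a,b⃗)} w·‖S[G_σ]‖ ≤ A_w`, the scale-`0` multiplier symbols have `(|β|L²)⁻¹ Σ_{(d,w⃗)} w·‖Σ_k F_ω(k) Χ_c(k; d, w⃗)‖ ≤ T_w`, the grid covariance is
replica-Gram-bounded (`κ`) and `θ_w = e·A_w·‖Ṽ‖_{h,wt}/κ² < 1`, then for every label 4-tuple `Ω` and legs `i`, `k`: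
`ε_x³·Σ_x spaceTimeDist(x_i,x_k)·‖klAnisoLegKernel … klE0 0 4 Ω (0,x)‖ ≤ ε_x³·T_w·(2T_w)³·(ρ⁻⁴·e f₂·(eA_w f₂/κ²)⁰/(1-θ_w)²)`, `f₂ = (e²(κ+ρ))⁴|U||β|/N`. -/
theorem firstMoment_zero_le_of_torusSums [NeZero M] {β : ℝ} (hβ : 0 < β) (U μ : ℝ) (K : TrigPolyC4v)
    {κ : ℝ} (hκ : 0 < κ)
    (hGB : IsGramBoundedR ((hubbardGridSub L M β (2 * (2 * M))).transpose * hubbardCovAboveCT L M β μ 0 K klE0 *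
      hubbardGridSub L M β (2 * (2 * M))) κ)
    {Aw : ℝ} (hAw : 0 < Aw)
    (hA : ∀ σ : Fin 2, ∑ a : TorusSite 1 (2 * (2 * M)), ∑ bv : TorusSite 2 L,
      (1 + (β / (2 * (2 * M) : ℕ) * cyclicDist (2 * (2 * M)) (a 0) 0 + torusSiteDist bv 0)) *
        ‖∑ q₀ : TorusSite 1 (2 * (2 * M)), ∑ qv : TorusSite 2 L, torusChar q₀ a * torusChar qv bv *
          gridSymbol L M (2 * (2 * M)) β (uvSymbolCT L M β μ K klE0) σ q₀ qv‖ ≤ Aw)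
    {ρ : ℝ} (hρ : 0 < ρ)
    (hθ : Real.exp 1 * Aw * normV (GridLeg (GridPoint L (2 * (2 * M)))) κ ρ
      (fun m' : ℕ => if m' = 1 then |β| / (2 * (2 * M) : ℕ) * ∑ z : TorusSite 2 L, ‖framePosKernel L K z‖ * (1 + torusSiteDist z 0)
        else if m' = 2 then |U| * |β| / (2 * (2 * M) : ℕ) else 0) / κ ^ 2 < 1)
    {Tw : ℝ} (hTw0 : 0 ≤ Tw)
    (hT : ∀ (ω : Fin (sectorCount 0)) (c : Fin 2), 1 / (|β| * (L : ℝ) ^ 2) *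
        ∑ dw : TorusSite 1 (2 * (2 * M)) × TorusSite 2 L,
          (1 + (β / (2 * (2 * M) : ℕ) * cyclicDist (2 * (2 * M)) (dw.1 0) 0 + torusSiteDist dw.2 0)) *
            ‖∑ k : FreqMomentum L M, klAnisoFamily L M β μ K klE0 0 ω k *
              (if c = 0 then torusChar (fun _ : Fin 1 => ((k.1 : ℕ) : ZMod (2 * (2 * M)))) dw.1 * torusChar k.2 dw.2
                else conj (torusChar (fun _ : Fin 1 => ((k.1 : ℕ) : ZMod (2 * (2 * M)))) dw.1 * torusChar k.2 dw.2))‖ ≤ Tw)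
    (Ω : Fin 4 → SectorLeg (sectorCount 0)) (i k : Fin 4) :
    imagTimeWeight β M ^ 3 *
        ∑ x : Fin 3 → SpaceTimeIdx L M,
          KLRegimeSplit.spaceTimeDist L M β (Matrix.vecCons (0 : SpaceTimeIdx L M) x i) (Matrix.vecCons (0 : SpaceTimeIdx L M) x k) *
            ‖klAnisoLegKernel L M β U μ K klE0 0 4 Ω (Matrix.vecCons (0 : SpaceTimeIdx L M) x)‖ ≤
      imagTimeWeight β M ^ 3 *
        (Tw * ((sectorCount 0 : ℕ) * Tw) ^ (2 * 2 - 1) *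
          (ρ⁻¹ ^ (2 * 2) * (Real.exp 1 * ((Real.exp 2 * (κ + ρ)) ^ (2 * 2) * (|U| * |β| / (2 * (2 * M) : ℕ)))) *
            (Real.exp 1 * Aw * ((Real.exp 2 * (κ + ρ)) ^ (2 * 2) * (|U| * |β| / (2 * (2 * M) : ℕ))) / κ ^ 2) ^ (2 - 2) /
              (1 - Real.exp 1 * Aw * normV (GridLeg (GridPoint L (2 * (2 * M)))) κ ρ
                (fun m' : ℕ => if m' = 1 then |β| / (2 * (2 * M) : ℕ) * ∑ z : TorusSite 2 L, ‖framePosKernel L K z‖ * (1 + torusSiteDist z 0)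
                  else if m' = 2 then |U| * |β| / (2 * (2 * M) : ℕ) else 0) / κ ^ 2) ^ 2)) := by
  haveI : NeZero (2 * (2 * M)) := ⟨by have := NeZero.ne M; omega⟩
  have hMN : 2 * M ≤ 2 * (2 * M) := by omega
  set φ : TorusSite 1 (2 * (2 * M)) → TorusSite 2 L → ℝ := fun a bv =>
    1 + (β / (2 * (2 * M) : ℕ) * cyclicDist (2 * (2 * M)) (a 0) 0 + torusSiteDist bv 0) with hφ
  have hφeven : ∀ a bv, φ (-a) (-bv) = φ a bv := fun a bv => scaleZeroMomentWeight_neg β a bv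
  have hφ0 : ∀ a bv, 0 ≤ φ a bv := fun a bv => scaleZeroMomentWeight_nonneg hβ.le a bv
  -- (α_w): the weighted rows / columns of the grid covariance
  have hrow : ∀ X, ∑ Y, ‖((hubbardGridSub L M β (2 * (2 * M))).transpose * hubbardCovAboveCT L M β μ 0 K klE0 *
      hubbardGridSub L M β (2 * (2 * M))) X Y‖ * gridLabelWt L (2 * (2 * M)) β {gridLegPos X, gridLegPos Y} ≤ Aw := by
    intro X
    rw [hubbardCovAboveCT_zero_seed_eq_normalCovariance_uvSymbolCT]
    refine le_of_eq_of_le (sum_congr rfl fun Y _ => by rw [gridLabelWt_pair_gridLegPos hβ.le]) ?_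
    exact sum_norm_mul_gridSub_pullback_row_le_of_weight hβ.ne' hMN _ φ hφeven hA X
  have hcol : ∀ Y, ∑ X, ‖((hubbardGridSub L M β (2 * (2 * M))).transpose * hubbardCovAboveCT L M β μ 0 K klE0 *
      hubbardGridSub L M β (2 * (2 * M))) X Y‖ * gridLabelWt L (2 * (2 * M)) β {gridLegPos X, gridLegPos Y} ≤ Aw := by
    intro Y
    rw [hubbardCovAboveCT_zero_seed_eq_normalCovariance_uvSymbolCT]
    refine le_of_eq_of_le (sum_congr rfl fun X _ => by rw [gridLabelWt_pair_gridLegPos hβ.le]) ?_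
    exact sum_norm_mul_gridSub_pullback_col_le_of_weight hβ.ne' hMN _ φ hφeven hA Y
  -- (cr_w / cc_w): the weighted rows / columns of the overlap kernel
  have hrow' : ∀ X'' : SpaceTimeIdx L M × SectorLeg (sectorCount 0), ∑ X' : GridLeg (GridPoint L (2 * (2 * M))),
      ‖(sectorAnalysisMatrix L M β (klAnisoFamily L M β μ K klE0 0) * hubbardGridSub L M β (2 * (2 * M))) X'' X'‖ *
        gridLabelWt L (2 * (2 * M)) β {latticeLegPos (2 * (2 * M)) X'', gridLegPos X'} ≤ Tw := by
    rintro ⟨y, ⟨⟨ω, σ⟩, c⟩⟩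
    -- only the columns `((q, σ), c)` contribute
    have hzero : ∀ X' : GridLeg (GridPoint L (2 * (2 * M))), (X'.1.2 ≠ σ ∨ X'.2 ≠ c) →
        (sectorAnalysisMatrix L M β (klAnisoFamily L M β μ K klE0 0) * hubbardGridSub L M β (2 * (2 * M))) (y, ((ω, σ), c)) X' = 0 := by
      intro X' h
      rw [sectorAnalysis_mul_hubbardGridSub_apply, if_neg]
      rintro ⟨h2, h3⟩
      rcases h with h | h
      · exact h h2
      · exact h h3
    calc ∑ X' : GridLeg (GridPoint L (2 * (2 * M))),
          ‖(sectorAnalysisMatrix L M β (klAnisoFamily L M β μ K klE0 0) * hubbardGridSub L M β (2 * (2 * M))) (y, ((ω, σ), c)) X'‖ *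
            gridLabelWt L (2 * (2 * M)) β {latticeLegPos (2 * (2 * M)) (y, ((ω, σ), c)), gridLegPos X'}
        = ∑ q : GridPoint L (2 * (2 * M)),
          ‖(sectorAnalysisMatrix L M β (klAnisoFamily L M β μ K klE0 0) * hubbardGridSub L M β (2 * (2 * M))) (y, ((ω, σ), c)) ((q, σ), c)‖ *
            φ (fun _ : Fin 1 => ((q.1 : ℕ) : ZMod (2 * (2 * M))) - 2 * ((y.1 : ℕ) : ZMod (2 * (2 * M)))) (q.2 - y.2) := by
          rw [Fintype.sum_prod_type, Fintype.sum_prod_type]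
          refine sum_congr rfl fun q _ => ?_
          rw [Fintype.sum_eq_single σ fun σ' hσ' => ?_, Fintype.sum_eq_single c fun c' hc' => ?_]
          · rw [gridLabelWt_pair_latticeLegPos_gridLegPos hβ.le]
          · rw [hzero ((q, σ), c') (Or.inr hc'), norm_zero, zero_mul]
          · exact sum_eq_zero fun c' _ => by rw [hzero ((q, σ'), c') (Or.inl hσ'), norm_zero, zero_mul]
      _ ≤ Tw := rowSum_mul_sectorAnalysis_mul_hubbardGridSub_le_of_weight hβ.ne' _ φ hT ω σ c y
  have hcol' : ∀ X' : GridLeg (GridPoint L (2 * (2 * M))), ∑ X'' : SpaceTimeIdx L M × SectorLeg (sectorCount 0),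
      ‖(sectorAnalysisMatrix L M β (klAnisoFamily L M β μ K klE0 0) * hubbardGridSub L M β (2 * (2 * M))) X'' X'‖ *
        gridLabelWt L (2 * (2 * M)) β {latticeLegPos (2 * (2 * M)) X'', gridLegPos X'} ≤ (sectorCount 0 : ℕ) * Tw := by
    rintro ⟨⟨q, σ⟩, c⟩
    have hzero : ∀ X'' : SpaceTimeIdx L M × SectorLeg (sectorCount 0), (X''.2.1.2 ≠ σ ∨ X''.2.2 ≠ c) →
        (sectorAnalysisMatrix L M β (klAnisoFamily L M β μ K klE0 0) * hubbardGridSub L M β (2 * (2 * M))) X'' ((q, σ), c) = 0 := by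
      intro X'' h
      rw [sectorAnalysis_mul_hubbardGridSub_apply, if_neg]
      rintro ⟨h2, h3⟩
      rcases h with h | h
      · exact h h2.symm
      · exact h h3.symm
    calc ∑ X'' : SpaceTimeIdx L M × SectorLeg (sectorCount 0),
          ‖(sectorAnalysisMatrix L M β (klAnisoFamily L M β μ K klE0 0) * hubbardGridSub L M β (2 * (2 * M))) X'' ((q, σ), c)‖ *
            gridLabelWt L (2 * (2 * M)) β {latticeLegPos (2 * (2 * M)) X'', gridLegPos ((q, σ), c)}
        = ∑ ω : Fin (sectorCount 0), ∑ y : SpaceTimeIdx L M,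
          ‖(sectorAnalysisMatrix L M β (klAnisoFamily L M β μ K klE0 0) * hubbardGridSub L M β (2 * (2 * M))) (y, ((ω, σ), c)) ((q, σ), c)‖ *
            φ (fun _ : Fin 1 => ((q.1 : ℕ) : ZMod (2 * (2 * M))) - 2 * ((y.1 : ℕ) : ZMod (2 * (2 * M)))) (q.2 - y.2) := by
          rw [Fintype.sum_prod_type, sum_comm, Fintype.sum_prod_type, Fintype.sum_prod_type]
          refine sum_congr rfl fun ω _ => ?_
          rw [Fintype.sum_eq_single σ fun σ' hσ' => ?_]
          · rw [Fintype.sum_eq_single c fun c' hc' => ?_]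
            · exact sum_congr rfl fun y _ => by rw [gridLabelWt_pair_latticeLegPos_gridLegPos hβ.le]
            · exact sum_eq_zero fun y _ => by rw [hzero (y, ((ω, σ), c')) (Or.inr hc'), norm_zero, zero_mul]
          · exact sum_eq_zero fun c' _ => sum_eq_zero fun y _ => by rw [hzero (y, ((ω, σ'), c')) (Or.inl hσ'), norm_zero, zero_mul]
      _ ≤ (sectorCount 0 : ℕ) * Tw := colSum_mul_sectorAnalysis_mul_hubbardGridSub_le_of_weight hβ.ne' _ φ hφ0 hT σ c q
  exact firstMoment_zero_le_of_wgridStep hβ U μ K hκ hGB hAw hrow hcol hρ hθ (by positivity) hrow' hcol' Ω i k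

end Summit.HubbardSuperconductivity.HubbardSuperconductivity.Theorems.EngineV8

end
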